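import Literature.MathematicalPhysics.QuantumFieldTheory.Balaban1983to89.B9LettersHHZWholeAtPins
import Literature.MathematicalPhysics.QuantumFieldTheory.Balaban1983to89.B9LettersHZAtOne
import Literature.MathematicalPhysics.QuantumFieldTheory.Balaban1983to89.B9CoReadingCoordsS
import Literature.MathematicalPhysics.QuantumFieldTheory.Balaban1983to89.B9LettersZSchemasMono

/-!
# BalabanUVNodes ∕ N06 ([B9], `Dag.B9_main`) — ROWS 20–21's HÖLDER PROBE `Φ^Y_β ∘ ∇_U ∘ G₀ ∘ Q*` (`LettersHHZ`, W-c face `hLHH`) AT def-Y's MEMBERS OF RECORD, FROM THE G₀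
# LAYER'S `Thm33G0Dir` — the member-∀ knit of dag-n06-w5's `B9LettersHHZWholeAtPins.lettersHHZ_pins` with [4] (2.61) above ONE threshold, at the CLOSED letter `Bh12 β·e^{δ_Q(ℓ+4)}·c_Q`

Track A of `YM-PLAN.md` (cell `pub-ymgap`, HUMAN RULING D-0062), node **N06** = [Balaban1985BackgroundPropagators] Thms 3.1–3.15; seat `pub-ymgap-dag-n06-d`
(s2, «knit N06 at the ₁₁ record»), gen 12.  A HELPER for the stage-11 certificate editions ≥ 37.

WHAT.  Editions 22–36 display rows 20–21's W-c schema `hLHH : … → LettersHHZ (𝔬12 x) (𝔭A x) 1 (H x) _ (weightNorm (ofBlocks (𝔬12 x).blkZ) ((L^{d+1})^{j})⁻¹ _) Bq12 δ12₃ U` —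
the Hölder probe `Φ^Y_β ∘ ∇_U ∘ G₀ ∘ Q*` ([B9] (3.126) p. 420, (3.43) p. 398, (3.40) p. 397, (3.153) p. 426) out of the weighted averaging class into `𝔠_P^{(β−1)}`, every `0 ≤ β < 1`.
It is dag-n06-w5's THEOREM `lettersHHZ_pins` (p628142) of the rows-19-derived direction members `Thm33G0Dir` (the certificate's `(hG0C …).1`, DERIVED since edition 16; field
`h43L β`), their `Q*`-letter `B9QstarLettersAtPins.hasMaj_Qstar_pins` (rate `δ_Q`) and dag-n06-l's `B9Thm313WholeQstarFromG0.pQ_of_h43`, for any `Bq β ≥ Bh β·e^{δ_Q(ℓ+4)}·c` and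
rates `0 ≤ δ₃ ≤ δ₀`, `δ₃ + σ ≤ δ_Q` — the rate inequality `δ12₃ ≤ δ12₀` IS print-intrinsic here (a probe of `∇_U G₀ Q*` decays no faster than Theorem 3.3's rate for `G₀`;
dag-n06-w5 ANSWER-LOCATED-ED36 (b)∕(c1)) and becomes the certificate's displayed numeric `hδ₃₀` (edition 37, `numerics_inhabited_ed37`).  THIS FILE states the knit ONCE, in the
member-∀ binder shape of the certificate:
★★ `hLHH_of_pins` — inputs: the pins `hβ1` (block map 1-faithful), `hblk12 ∕ hblkZ12` (carrier block maps `blkBK (bI x) ∕ blkHK`), `hQsco12` (`Q*` = def-Y's coordinate model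
`QscoKH … (parBY …)`); the signs `hBh12`, `0 ≤ δ12₃`, `δ12₃ ≤ δ12₀`; the face `h33` as a ∀-family in the regime (M₀, a₀) under (3.35)∕(3.36).  Output: `∃ (MQ : ℝ) (Bq : ℝ → ℝ), (∀ β, 0 ≤ Bq β) ∧ (∀ x,
MQ ≤ M_x → ∀ α₀ > 0, M_xα₀ ≤ a₀ → ∀ U, Reg335 → Reg336 → LettersHHZ (𝔬12 x) (𝔭A x) 1 (H x) _ (weightNorm …) Bq δ12₃ U) ∧ (∀ x U, Letters313DMZ … B12₃ Bq12 δ12₃ (bH13 x) U →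
Letters313DMZ … B12₃ Bq δ12₃ (bH13 x) U)`, with the CLOSED witnesses `MQ := max M₀ M_L` and THE LETTER `Bq := Bq⋆ β := max (Bq12 β) (Bh12 β·e^{(δ12₃+1)(ℓ+4)}·max c₁ 0)`
([4] (2.61) at rate 1, `rowSum261_geo9Y`; `σ := 1`, `δ_Q := δ12₃ + 1`) — dag-n06-w5's route (c1): the displayed `Bq12` stays the letter of `hlettersD13` (`Letters313DMZ`), which is
LIFTED to `Bq⋆` by their `B9LettersZSchemasMono.letters313DMZ_mono` (third clause), so that rows 20–21's leaf `t312_t313_of_pins_pairMBCZ_phys` reads ONE `Bq`.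
HONEST FRAMING.  Kernel bookkeeping (one application of dag-n06-w5's theorem per member and configuration); COUNT-NEUTRAL; nothing of [B9] asserted — the `Thm33G0Dir` family
is the certificate's derived family, displayed here as a hypothesis; N06 NOT discharged.  One finite 𝕋⁴ programme at fixed `ε` — NOT continuum, NOT OS, NOT the mass gap ∕ Clay.
0 `def`, 0 `sorry`.
-/

noncomputable section

namespace Summit.QuantumFields.YangMills.BalabanUVNodes.N06HHLegAtPinsPhys

open Literature.MathematicalPhysics.QuantumFieldTheory.Balaban1983to89
open Literature.MathematicalPhysics.QuantumFieldTheory.Balaban1983to89.Node00 (FBondY IBondY parBY)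
open Literature.MathematicalPhysics.QuantumFieldTheory.Balaban1983to89.B9Thm34Ext (toB6)
open Literature.MathematicalPhysics.QuantumFieldTheory.Balaban1983to89.B11SectG (HasMaj BlockNorm RowSum)
open Literature.MathematicalPhysics.QuantumFieldTheory.Balaban1983to89.B9SectDSup (weightNorm)
open Literature.MathematicalPhysics.QuantumFieldTheory.Balaban1983to89.B9RWSums343Holder (HolderProbes)
open Literature.MathematicalPhysics.QuantumFieldTheory.Balaban1983to89.B9Thm312WholeDir (Thm33G0Dir)
open Literature.MathematicalPhysics.QuantumFieldTheory.Balaban1983to89.B9Thm312WholeHZ (LettersHHZ)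
open Literature.MathematicalPhysics.QuantumFieldTheory.Balaban1983to89.B9CoReadingCoords (XBK blkBK)
open Literature.MathematicalPhysics.QuantumFieldTheory.Balaban1983to89.B9CoReadingCoordsS (XSK)
open Literature.MathematicalPhysics.QuantumFieldTheory.Balaban1983to89.B9CoReadingCoordsH (XHK blkHK)
open Literature.MathematicalPhysics.QuantumFieldTheory.Balaban1983to89.B9CoReadingCoordsTranspose (TrIdx trBasis)
open Literature.MathematicalPhysics.QuantumFieldTheory.Balaban1983to89.B9LettersHHZWholeAtPins (lettersHHZ_pins)
open Literature.MathematicalPhysics.QuantumFieldTheory.Balaban1983to89.B9LettersZSchemasMono (letters313DMZ_mono)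
open Literature.MathematicalPhysics.QuantumFieldTheory.Balaban1983to89.B9Thm313WholeDirZ (Letters313DMZ)
open Literature.MathematicalPhysics.QuantumFieldTheory.Balaban1983to89.B9GeoLemma21KLevelV1 (geo9Y_dist_triangle geo9Y_dist_comm)
open Literature.MathematicalPhysics.QuantumFieldTheory.Balaban1983to89.B9GeoNormsKLevelV1 (geo9K_dist_nonneg)
open Literature.MathematicalPhysics.QuantumFieldTheory.Balaban1983to89.B9LettersHZAtOne (plateau_pos)
open Literature.MathematicalPhysics.QuantumFieldTheory.Balaban1983to89.B9PinMembersKLevelV1 (MemberY geo9Y bg9Y)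
open Literature.MathematicalPhysics.QuantumFieldTheory.Balaban1983to89.B9GeoLemma21KLevelV1 (geo9Y_len_pos rowSum261_geo9Y)
open Literature.MathematicalPhysics.QuantumFieldTheory.Balaban1983to89.Node00.OpsYSectDCoords (QscoKH)
open Literature.MathematicalPhysics.QuantumFieldTheory.Balaban1983to89.B7Prop2SpecialUnitary (specialUnitaryUnits)
open Literature.MathematicalPhysics.QuantumFieldTheory.Balaban1983to89.B6GlobalChartV1 (blkV1)
open Literature.MathematicalPhysics.QuantumFieldTheory.Balaban1983to89.B6Ineq2142KLevelV1 (β lvl)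
open Literature.MathematicalPhysics.QuantumFieldTheory.Balaban1983to89.B6Geom246MultiLevelTorus (geomT)
open scoped Matrix.Norms.L2Operator

variable {d ℓ : ℕ} {hd : 1 ≤ d + 1} {hL : Odd (ℓ + 1) ∧ 1 < ℓ + 1} {b₀ b₁ : ℝ} {Mstar : ℕ} {N : ℕ} [NeZero N]
variable [∀ x : MemberY d ℓ hd hL b₀ b₁ Mstar, Fintype (geo9Y x).Site]

/-- ★★ **`hLHH` AT THE MEMBERS OF RECORD FROM THE G₀ LAYER'S `Thm33G0Dir`, ABOVE ONE THRESHOLD, AT THE LETTER `Bq⋆ := max Bq12 (Bh12·e^{(δ12₃+1)(ℓ+4)}·c_Q)`, WITH THE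
`Letters313DMZ` LIFT TO THE SAME LETTER** (module docstring): `Φ^Y_β ∘ ∇_U ∘ G₀ ∘ Q*` out of the weighted averaging class on `(𝔬12 x).blkZ = blkHK` into `𝔠_P^{(β−1)}` with
`Bq⋆ β·e^{−δ12₃d}`, every member above `MQ := max M₀ M_L`, every `U` of the (3.35)∕(3.36) class in the regime (M₀, a₀) — from dag-n06-w5's `lettersHHZ_pins` (`σ := 1`,
`δ_Q := δ12₃ + 1`, [4] (2.61) at rate 1) at the pins `hβ1 hblk12 hblkZ12 hQsco12` and the rate inequality `δ12₃ ≤ δ12₀`; and `Letters313DMZ … Bq12 … → Letters313DMZ … Bq⋆ …`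
by dag-n06-w5's `letters313DMZ_mono`.
[cite: Balaban1985BackgroundPropagators, (3.126) p.420 + (3.43) p.398 + (3.40) p.397 + (3.153) p.426 + (3.35) p.396 + (3.8) p.392; Balaban1984PropagatorsII, (2.51)–(2.56) pp.232–233 + Lemma 2.1 (2.60)–(2.61) p.234] -/
theorem hLHH_of_pins {PX PY : MemberY d ℓ hd hL b₀ b₁ Mstar → Type} [∀ x, Fintype (PX x)] [∀ x, Fintype (PY x)]
    (H : MemberY d ℓ hd hL b₀ b₁ Mstar → Prop)
    (bI : ∀ x : MemberY d ℓ hd hL b₀ b₁ Mstar, FBondY x.toKIdx → IBondY x.toKIdx)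
    (hβ1 : ∀ (x : MemberY d ℓ hd hL b₀ b₁ Mstar) (f : FBondY x.toKIdx), (geomT x.D).dist (β x.hN x.D x.hk (bI x f)) (blkV1 x.hN x.D f) ≤ 1)
    (𝔭A : ∀ x : MemberY d ℓ hd hL b₀ b₁ Mstar, HolderProbes (geo9Y x) (bg9Y (Matrix (Fin N) (Fin N) ℂ) (specialUnitaryUnits (Fin N)) x) (XBK (TrIdx N) x.toKIdx)
      (XBK (TrIdx N) x.toKIdx) (PX x) (PY x))
    (Dd Dds : ∀ x : MemberY d ℓ hd hL b₀ b₁ Mstar, (bg9Y (Matrix (Fin N) (Fin N) ℂ) (specialUnitaryUnits (Fin N)) x).Cfg → Fin (d + 1) →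
      Module.End ℝ (XBK (TrIdx N) x.toKIdx → ℝ))
    (bHXA : ∀ x : MemberY d ℓ hd hL b₀ b₁ Mstar, ℝ → BlockNorm (toB6 (geo9Y x) 1 (H x)) ((XBK (TrIdx N) x.toKIdx) → ℝ))
    (𝔬12 : ∀ x : MemberY d ℓ hd hL b₀ b₁ Mstar, B9Thm312Whole.Ops (geo9Y x) (bg9Y (Matrix (Fin N) (Fin N) ℂ) (specialUnitaryUnits (Fin N)) x)
      (XBK (TrIdx N) x.toKIdx) (XBK (TrIdx N) x.toKIdx) (XHK (TrIdx N) x.toKIdx) (XSK (TrIdx N) x.toKIdx))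
    (hblk12 : ∀ x : MemberY d ℓ hd hL b₀ b₁ Mstar, (𝔬12 x).blk = blkBK x.toKIdx (bI x))
    (hblkZ12 : ∀ x : MemberY d ℓ hd hL b₀ b₁ Mstar, (𝔬12 x).blkZ = blkHK x.toKIdx)
    (hQsco12 : ∀ (x : MemberY d ℓ hd hL b₀ b₁ Mstar) (U : (bg9Y (Matrix (Fin N) (Fin N) ℂ) (specialUnitaryUnits (Fin N)) x).Cfg),
      (𝔬12 x).Qstar U = QscoKH x.toKIdx (trBasis N) (bg9Y (Matrix (Fin N) (Fin N) ℂ) (specialUnitaryUnits (Fin N)) x) (fun U => U) (parBY x.toKIdx) U)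
    (bH13 : ∀ x : MemberY d ℓ hd hL b₀ b₁ Mstar, BlockNorm (toB6 (geo9Y x) 1 (H x)) (XSK (TrIdx N) x.toKIdx → ℝ)) (Bq12 : ℝ → ℝ) (hBq12 : ∀ β, 0 ≤ Bq12 β)
    {B12₀ δ12₀ B12₃ δ12₃ M₀ a₀ c35 : ℝ} {Bh12 Bi12 : ℝ → ℝ} {Bi2₁₂ : ℝ → ℝ → ℝ}
    (hB12₃ : 0 ≤ B12₃) (hBh12 : ∀ β, 0 ≤ β → β < 1 → 0 ≤ Bh12 β) (hδ12₃ : 0 ≤ δ12₃) (hδ₃₀ : δ12₃ ≤ δ12₀)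
    (h33 : ∀ x : MemberY d ℓ hd hL b₀ b₁ Mstar, M₀ ≤ (geo9Y x).M → ∀ α₀ : ℝ, 0 < α₀ → (geo9Y x).M * α₀ ≤ a₀ →
      ∀ U : (bg9Y (Matrix (Fin N) (Fin N) ℂ) (specialUnitaryUnits (Fin N)) x).Cfg,
        (bg9Y (Matrix (Fin N) (Fin N) ℂ) (specialUnitaryUnits (Fin N)) x).Reg335 c35 α₀ U →
        (bg9Y (Matrix (Fin N) (Fin N) ℂ) (specialUnitaryUnits (Fin N)) x).Reg336 c35 α₀ U →
          Thm33G0Dir (𝔬12 x) (𝔭A x) (Dd x) (Dds x) 1 (H x) (bHXA x) B12₀ Bh12 Bi12 Bi2₁₂ δ12₀ U) :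
    ∃ (MQ : ℝ) (Bq : ℝ → ℝ), (∀ β, 0 ≤ Bq β) ∧
      (∀ x : MemberY d ℓ hd hL b₀ b₁ Mstar, MQ ≤ (geo9Y x).M → ∀ α₀ : ℝ, 0 < α₀ → (geo9Y x).M * α₀ ≤ a₀ →
        ∀ U : (bg9Y (Matrix (Fin N) (Fin N) ℂ) (specialUnitaryUnits (Fin N)) x).Cfg,
          (bg9Y (Matrix (Fin N) (Fin N) ℂ) (specialUnitaryUnits (Fin N)) x).Reg335 c35 α₀ U →
          (bg9Y (Matrix (Fin N) (Fin N) ℂ) (specialUnitaryUnits (Fin N)) x).Reg336 c35 α₀ U →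
            LettersHHZ (𝔬12 x) (𝔭A x) 1 (H x) (fun y => (geo9Y_len_pos x y).le)
              (weightNorm (BlockNorm.ofBlocks (toB6 (geo9Y x) 1 (H x)) (𝔬12 x).blkZ) (fun y => ((((ℓ + 1 : ℕ) : ℝ) ^ (d + 1)) ^ lvl x.hN x.D x.hk y)⁻¹)
                (fun y => (plateau_pos x.toKIdx y).le)) Bq δ12₃ U) ∧
      (∀ (x : MemberY d ℓ hd hL b₀ b₁ Mstar) (U : (bg9Y (Matrix (Fin N) (Fin N) ℂ) (specialUnitaryUnits (Fin N)) x).Cfg),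
        Letters313DMZ (𝔬12 x) (𝔭A x) (Dd x) 1 (H x) ⟨geo9Y_dist_triangle x, geo9Y_dist_comm x, geo9K_dist_nonneg x.toKIdx, geo9Y_len_pos x⟩
            (fun y => ((((ℓ + 1 : ℕ) : ℝ) ^ (d + 1)) ^ lvl x.hN x.D x.hk y)⁻¹) (fun y => plateau_pos x.toKIdx y) B12₃ Bq12 δ12₃ (bH13 x) U →
          Letters313DMZ (𝔬12 x) (𝔭A x) (Dd x) 1 (H x) ⟨geo9Y_dist_triangle x, geo9Y_dist_comm x, geo9K_dist_nonneg x.toKIdx, geo9Y_len_pos x⟩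
            (fun y => ((((ℓ + 1 : ℕ) : ℝ) ^ (d + 1)) ^ lvl x.hN x.D x.hk y)⁻¹) (fun y => plateau_pos x.toKIdx y) B12₃ Bq δ12₃ (bH13 x) U) := by
  -- [4] (2.61) at rate 1 above ONE threshold, constant floored at 0; the letter `Bq⋆ := max Bq12 (Bh12·e^{(δ12₃+1)(ℓ+4)}·c_Q)` (dag-n06-w5 (c1))
  obtain ⟨ML, c₁, hrow⟩ := rowSum261_geo9Y (d := d) (ℓ := ℓ) (hd := hd) (hL := hL) (b₀ := b₀) (b₁ := b₁) (Mstar := Mstar) 1 one_pos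
  refine ⟨max M₀ ML, fun β => max (Bq12 β) (Bh12 β * Real.exp ((δ12₃ + 1) * ((ℓ : ℝ) + 4)) * max c₁ 0),
    fun β => (hBq12 β).trans (le_max_left _ _), fun x hM α₀ hα ha U hU hU' => ?_, fun x U h => ?_⟩
  · have hrowx : RowSum (toB6 (geo9Y x) 1 (H x)) 1 (max c₁ 0) := fun y => (hrow x ((le_max_right _ _).trans hM) y).trans (le_max_left _ _)
    exact lettersHHZ_pins x (hβ1 x) hU hrowx (le_max_right _ _) hBh12 (δQ := δ12₃ + 1) (by linarith only [hδ12₃]) hδ12₃ hδ₃₀ (by linarith only)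
      (fun _ _ _ => le_max_right _ _) (hblk12 x) (hblkZ12 x) (hQsco12 x U) (h33 x ((le_max_left _ _).trans hM) α₀ hα ha U hU hU')
      (fun y => (plateau_pos x.toKIdx y).le)
  · exact letters313DMZ_mono _ hB12₃ le_rfl (fun β _ _ => hBq12 β) (fun β _ _ => le_max_left _ _) le_rfl h

end Summit.QuantumFields.YangMills.BalabanUVNodes.N06HHLegAtPinsPhys

end
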